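import Literature.AlgebraicGeometry.Frobenioids.Monoids
import HarnessLib

/-!
# Frobenioids I, §0: every monoid automorphism of a `ℤ`-monoprime monoid is the identity (`Aut(ℤ_{≥0}) = 1`)

Mochizuki, *The geometry of Frobenioids I: the general theory*, Kyushu J. Math. **62** (2008) 293–400, §0
p. 10 (monoprime monoids: `M ≅ ℤ_{≥0}`, `ℚ_{≥0}` or `ℝ_{≥0}`). [cite: MochizukiFrdI2008, §0 p.10] A folklore
tool (cell abc-iut; seat abc-iut-w5-d250), recorded for the interface datum G-w5d250-1 of `plan/GAP-LEDGER.md`: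
the pull-back along an automorphism of an object acts by a monoid AUTOMORPHISM on the monoprime monoid of
divisors of base-field constants ([EtTh] Def. 3.6 (ii)(a)); for monoid type `ℤ` that monoid is `ℤ`-monoprime, so
the action is trivial with no further input:
* `mulEquiv_multiplicative_nat_apply` — an automorphism of `(ℕ, +)` (written multiplicatively) is the identity:
  it is `k ↦ k · c` with `c` the image of the generator, and surjectivity forces `c = 1`;
* `IsZMonoprime.mulEquiv_apply` — hence every monoid automorphism of a `ℤ`-monoprime monoid is the identity.
No definitions; nothing here bears on [IUTchIII] Cor. 3.12.
-/

namespace Literature.AlgebraicGeometry.Frobenioids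

open Function

universe u

variable {M : Type u} [CommMonoid M]

/-- An automorphism of the monoid `ℤ_{≥0}` of FrdI §0 p. 10 (here `Multiplicative ℕ`) is the identity (it is
`k ↦ k · c`, and surjectivity forces `c = 1`). [cite: MochizukiFrdI2008, §0 p.10] -/
theorem mulEquiv_multiplicative_nat_apply (ψ : Multiplicative ℕ ≃* Multiplicative ℕ) (x : Multiplicative ℕ) :
    ψ x = x := by
  -- `ψ (ofAdd k) = ofAdd (k * c)` with `c := toAdd (ψ (ofAdd 1))`
  set c : ℕ := Multiplicative.toAdd (ψ (Multiplicative.ofAdd 1)) with hc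
  have hpow : ∀ k : ℕ, ψ (Multiplicative.ofAdd k) = Multiplicative.ofAdd (k * c) := by
    intro k
    induction k with
    | zero =>
      rw [Nat.zero_mul]
      exact map_one ψ
    | succ k ih =>
      rw [Nat.succ_mul, ofAdd_add, map_mul, ih, ofAdd_add, hc, ofAdd_toAdd]
  -- surjectivity: `ofAdd 1 = ψ (ofAdd m) = ofAdd (m * c)` forces `c = 1`
  have hc1 : c = 1 := by
    obtain ⟨y, hy⟩ := ψ.surjective (Multiplicative.ofAdd 1)
    have hy' : Multiplicative.ofAdd (Multiplicative.toAdd y * c) = Multiplicative.ofAdd 1 := by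
      rw [← hpow, ofAdd_toAdd, hy]
    have h := congrArg Multiplicative.toAdd hy'
    rw [toAdd_ofAdd, toAdd_ofAdd] at h
    exact Nat.eq_one_of_mul_eq_one_left h
  have hx := hpow (Multiplicative.toAdd x)
  rw [ofAdd_toAdd, hc1, mul_one, ofAdd_toAdd] at hx
  exact hx

/-- **Every monoid automorphism of a `ℤ`-monoprime monoid is the identity** (`Aut(ℤ_{≥0}, +) = 1`); in
particular a group acting on such a monoid by monoid automorphisms acts trivially. [cite: MochizukiFrdI2008, §0 p.10] -/
theorem IsZMonoprime.mulEquiv_apply (h : IsZMonoprime M) (φ : M ≃* M) (x : M) : φ x = x := by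
  obtain ⟨e⟩ := h.nonempty_mulEquiv
  have hx : (e.symm.trans (φ.trans e)) (e x) = e x := mulEquiv_multiplicative_nat_apply _ _
  rw [MulEquiv.trans_apply, MulEquiv.trans_apply, MulEquiv.symm_apply_apply] at hx
  exact e.injective hx

end Literature.AlgebraicGeometry.Frobenioids
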